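import Mathlib
import Literature.Probability.Percolation.NestingPhaseEstimates
import Literature.Probability.RandomPlanarGeometry.LocFinLoopConfig
import Summits.CriticalPhenomena.CardyFormulaZ2.Theorems.CardyMagicRigidityMagicFormulaTUVAssemblyToolkit
import HarnessLib

/-!
# Matching toolkit for the deterministic comparison of threshold-averaged big-loop weights
(crux `MagicFormulaT`, line `Sketch` v7, stub `stub_closeComparison`) — part 1/2

Crux `Summit.CriticalPhenomena.CardyFormulaZ2.Theses.CardyMagicRigidity.MagicFormulaT`
(stmt-CriticalPhenomena-4836), line `Sketch`, skeleton v7 (EXISTENCE ∧ IDENTIFICATION), stub B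
(`stub_closeComparison`, landed in part 2/2 `…CloseComparison.lean`).  This first file collects the lattice-free
lemmas of that comparison; registered sub-goal: `closeComparison_pairSum`.

Notation: `θ_u = ∫_{int u} f` (`UnbasedLoop.nestingPhase`), `cos_μ(θ) = 2cos(θ + π/3)` (`UnbasedLoop.nestingFactor`),
`d` = DKKMO's unoriented loop distance (`UnbasedLoop.udist`), thresholds `η_j = η/2 + (j+1)η/(2m)`, and for a loop `u`
and a threshold `t` the factor `a_t(u) = [t ≤ diam u] cos_μ(θ_u) + [t > diam u]`.

* §1 `|cos_μ(θ_u) − 1| ≤ 2|θ_u|`, hence `≤ 4πCη²` when `diam u ≤ 5η/4` (`cc_abs_nestingFactor_sub_one_le_of_diam_le`,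
  via the landed `uva_abs_nestingPhase_le_sq : |θ_u| ≤ πC diam(u)²` of the UV assembly toolkit).
* §2 `η_j ≤ η` for `j < m`; **at most one threshold is mixed** (`cc_threshold_unique`): if `|dx − dy| ≤ 2ε` and
  `8mε ≤ η` (spacing `η/(2m) ≥ 4ε`), two thresholds that both separate `dx` from `dy` coincide.
* §3 **Per-pair estimate** (`cc_sum_abs_sub_le`, registered closed form `closeComparison_pairSum`): for `d(x,y) ≤ ε`
  with the `ε`-sausage of `x` of area `≤ τ` in `B̄(0,R)`, `Σ_{j<m} |a_{η_j}(x) − a_{η_j}(y)| ≤ m·2Cτ + 4πCη²` (both big: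
  `2Cτ` by `abs_nestingFactor_sub_le` + `abs_nestingPhase_sub_le_of_udist_le`; both small: `0`; mixed: `4πCη²`, once).
* §4 Matching: both members of a matched pair are relevant (`cc_pair_rel`: meet `B̄(0,R+1)`, `diam ≥ η/5`);
  ribbon-freeness (`2ε`-separation of relevant loops) makes partners unique (`cc_eq_of_udist_le`); `d_CN ≤ ε` plus the
  window give partners (`cc_exists_partner`).
* §5 `A^t_f(d) = ∏_{p ∈ P} a_t(proj p)` for an injectively labelled finite family covering the loops meeting `B̄(0,R)` of
  diameter `≥ s ≤ t` (`cc_truncNestingWeight_eq_prod`; other loops have factor `1`,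
  `range_inter_closedBall_nonempty_of_nestingFactor_ne_one`).
* §6 Averaging products of factors bounded by `2` (`cc_abs_avg_sub_avg_le`, from `Finset.abs_prod_sub_prod_le`).

Everything is proved from tree material (`NestingPhaseEstimates`, `LocFinLoopConfig`, `LoopConfigurations`,
`NestingTransform`, `…MagicFormulaTUVAssemblyToolkit`); no definition, no cited fact.  Helper names carry the
prefix `cc_`.
-/

noncomputable section

namespace Summit.CriticalPhenomena.CardyFormulaZ2.Cruxes.MagicFormulaT.LineSketch

open MeasureTheory Filter Set Metric
open scoped Real Topology BigOperators ENNReal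
open Literature.Probability.RandomPlanarGeometry Literature.Probability.Percolation
  Literature.Probability.LatticeModels

/-! ## §1 Phase and weight bounds for a single loop -/

section Phase

variable {f : ℂ → ℝ} {R C : ℝ}

/-- **`|cos_μ(θ_u) − 1| ≤ 2|θ_u|`** (`cos_μ(0) = 1` and `cos_μ` is `2`-Lipschitz in the phase). -/
theorem cc_abs_nestingFactor_sub_one_le (f : ℂ → ℝ) (u : UnbasedLoop ℂ) :
    |u.nestingFactor f - 1| ≤ 2 * |u.nestingPhase f| := by
  have h := abs_nestingFactor_sub_le f 0 u u
  rwa [UnbasedLoop.nestingFactor_zero, UnbasedLoop.nestingPhase_zero, sub_zero] at h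

/-- The mixed-case bound: a loop of diameter `≤ 5η/4` has `|cos_μ(θ_u) − 1| ≤ 4πCη²`. -/
theorem cc_abs_nestingFactor_sub_one_le_of_diam_le (hC : ∀ z, |f z| ≤ C) (hR : ∀ z, R < ‖z‖ → f z = 0)
    {η : ℝ} {u : UnbasedLoop ℂ} (hu : diam u.range ≤ 5 * η / 4) :
    |u.nestingFactor f - 1| ≤ 4 * π * C * η ^ 2 := by
  have hC0 : 0 ≤ C := nonneg_of_abs_le hC
  have hπC : 0 ≤ π * C := mul_nonneg Real.pi_pos.le hC0
  have hd2 : diam u.range ^ 2 ≤ (5 * η / 4) ^ 2 := pow_le_pow_left₀ diam_nonneg hu 2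
  calc |u.nestingFactor f - 1| ≤ 2 * |u.nestingPhase f| := cc_abs_nestingFactor_sub_one_le f u
    _ ≤ 2 * (π * C * diam u.range ^ 2) := by
        gcongr
        exact uva_abs_nestingPhase_le_sq hC hR u
    _ ≤ 2 * (π * C * (5 * η / 4) ^ 2) := by gcongr
    _ ≤ 4 * π * C * η ^ 2 := by nlinarith [mul_nonneg hπC (sq_nonneg η)]

end Phase

/-! ## §2 Thresholds: `η_j = η/2 + (j+1)η/(2m)`; at most one of them separates two `2ε`-close diameters -/

/-- The thresholds lie in `[η/2, η]`: upper bound for `j < m`. -/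
theorem cc_threshold_le {η : ℝ} {m j : ℕ} (hη : 0 ≤ η) (hj : j ∈ Finset.range m) :
    η / 2 + ((j : ℝ) + 1) * η / (2 * m) ≤ η := by
  have hjm : (j : ℝ) + 1 ≤ m := by exact_mod_cast Finset.mem_range.1 hj
  have hm : (0 : ℝ) < m := by
    have : (0 : ℝ) ≤ j := Nat.cast_nonneg j
    linarith
  have h : ((j : ℝ) + 1) * η / (2 * m) ≤ η / 2 := by
    rw [div_le_div_iff₀ (by positivity) (by positivity)]
    nlinarith [mul_le_mul_of_nonneg_right hjm hη]
  linarith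

/-- **At most one threshold is mixed.**  If `dx, dy` differ by at most `2ε` and the thresholds are `η/(2m) ≥ 4ε`
apart (`8mε ≤ η`), then two thresholds `η_j, η_k` (`j < m`) which both separate `dx` from `dy` (one of the
two diameters is `≥` the threshold, the other `<`) coincide. -/
theorem cc_threshold_unique {dx dy ε η : ℝ} {m : ℕ} (hε : 0 < ε) (hmε : 8 * m * ε ≤ η)
    (hdx : dx ≤ dy + 2 * ε) (hdy : dy ≤ dx + 2 * ε) {j k : ℕ} (hj : j ∈ Finset.range m)
    (hmj : (η / 2 + ((j : ℝ) + 1) * η / (2 * m) ≤ dx ∧ ¬ η / 2 + ((j : ℝ) + 1) * η / (2 * m) ≤ dy) ∨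
      (¬ η / 2 + ((j : ℝ) + 1) * η / (2 * m) ≤ dx ∧ η / 2 + ((j : ℝ) + 1) * η / (2 * m) ≤ dy))
    (hmk : (η / 2 + ((k : ℝ) + 1) * η / (2 * m) ≤ dx ∧ ¬ η / 2 + ((k : ℝ) + 1) * η / (2 * m) ≤ dy) ∨
      (¬ η / 2 + ((k : ℝ) + 1) * η / (2 * m) ≤ dx ∧ η / 2 + ((k : ℝ) + 1) * η / (2 * m) ≤ dy)) :
    j = k := by
  have hm : 0 < m := by
    have := Finset.mem_range.1 hj
    omega
  have hm' : (0 : ℝ) < m := by exact_mod_cast hm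
  have hη : 0 ≤ η := by
    have : (1 : ℝ) ≤ m := by exact_mod_cast hm
    nlinarith
  -- the spacing of the thresholds is at least `4ε`
  have hgap : ∀ {a b : ℕ}, a < b →
      η / 2 + ((a : ℝ) + 1) * η / (2 * m) + 4 * ε ≤ η / 2 + ((b : ℝ) + 1) * η / (2 * m) := by
    intro a b hab
    have hab' : (a : ℝ) + 1 ≤ b := by exact_mod_cast hab
    have h1 : 4 * ε ≤ η / (2 * m) := by
      rw [le_div_iff₀ (by positivity)]
      linarith
    have h2 : ((a : ℝ) + 1) * η / (2 * m) + η / (2 * m) ≤ ((b : ℝ) + 1) * η / (2 * m) := by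
      rw [← add_div]
      apply div_le_div_of_nonneg_right _ (by positivity)
      nlinarith [mul_le_mul_of_nonneg_right hab' hη]
    linarith
  by_contra hne
  push Not at hmj hmk
  rcases Nat.lt_or_gt_of_ne hne with h | h
  · have hg := hgap h
    rcases hmj with ⟨a1, a2⟩ | ⟨a1, a2⟩ <;> rcases hmk with ⟨b1, b2⟩ | ⟨b1, b2⟩ <;> linarith
  · have hg := hgap h
    rcases hmj with ⟨a1, a2⟩ | ⟨a1, a2⟩ <;> rcases hmk with ⟨b1, b2⟩ | ⟨b1, b2⟩ <;> linarith

/-! ## §3 Per matched pair: the sum over thresholds of the factor differences -/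

section Pair

variable {f : ℂ → ℝ} {R C : ℝ}

/-- **Per-pair estimate.**  For two loops `x, y` at unoriented distance `d(x, y) ≤ ε` whose `ε`-sausage (of `x`)
has area `≤ τ` in `B̄(0, R)`, with `8mε ≤ η`, `0 < m`: the sum over the `m` thresholds `η_j` of
`|a_j(x) − a_j(y)|`, `a_j(u) = [η_j ≤ diam u] cos_μ(θ_u) + [η_j > diam u]`, is at most `m · 2Cτ + 4πCη²`
(both big: `2Cτ`; both small: `0`; mixed: `≤ 4πCη²`, at most once by `cc_threshold_unique`). -/
theorem cc_sum_abs_sub_le (hf : Measurable f) (hC : ∀ z, |f z| ≤ C) (hR : ∀ z, R < ‖z‖ → f z = 0)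
    {x y : UnbasedLoop ℂ} {ε η τ : ℝ} {m : ℕ} (hε : 0 < ε) (hm : 0 < m) (hmε : 8 * m * ε ≤ η)
    (hxy : x.udist y ≤ ε)
    (hV : volume.real ({z : ℂ | infDist z x.range ≤ ε} ∩ closedBall (0 : ℂ) R) ≤ τ) :
    ∑ j ∈ Finset.range m,
      |(if η / 2 + ((j : ℝ) + 1) * η / (2 * m) ≤ diam x.range then x.nestingFactor f else 1) -
        (if η / 2 + ((j : ℝ) + 1) * η / (2 * m) ≤ diam y.range then y.nestingFactor f else 1)| ≤
      m * (2 * C * τ) + 4 * π * C * η ^ 2 := by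
  classical
  have hC0 : 0 ≤ C := nonneg_of_abs_le hC
  have hτ : 0 ≤ τ := le_trans measureReal_nonneg hV
  have hεη : 8 * ε ≤ η := by
    have : (1 : ℝ) ≤ m := by exact_mod_cast hm
    nlinarith
  have hη : 0 ≤ η := by linarith
  have hdx : diam x.range ≤ diam y.range + 2 * ε := UnbasedLoop.diam_range_le_of_udist_le x y hxy
  have hdy : diam y.range ≤ diam x.range + 2 * ε :=
    UnbasedLoop.diam_range_le_of_udist_le y x (by rwa [UnbasedLoop.udist_comm])
  have hfac : |x.nestingFactor f - y.nestingFactor f| ≤ 2 * C * τ := by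
    calc |x.nestingFactor f - y.nestingFactor f|
        ≤ 2 * |x.nestingPhase f - y.nestingPhase f| := abs_nestingFactor_sub_le f f x y
      _ ≤ 2 * (C * volume.real ({z : ℂ | infDist z x.range ≤ ε} ∩ closedBall (0 : ℂ) R)) := by
          gcongr
          exact abs_nestingPhase_sub_le_of_udist_le hf hC hR hxy
      _ ≤ 2 * (C * τ) := by gcongr
      _ = 2 * C * τ := by ring
  -- the mixed thresholds
  set mixed : ℕ → Prop := fun j ↦
    (η / 2 + ((j : ℝ) + 1) * η / (2 * m) ≤ diam x.range ∧
        ¬ η / 2 + ((j : ℝ) + 1) * η / (2 * m) ≤ diam y.range) ∨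
      (¬ η / 2 + ((j : ℝ) + 1) * η / (2 * m) ≤ diam x.range ∧
        η / 2 + ((j : ℝ) + 1) * η / (2 * m) ≤ diam y.range) with hmixed
  have hterm : ∀ j ∈ Finset.range m,
      |(if η / 2 + ((j : ℝ) + 1) * η / (2 * m) ≤ diam x.range then x.nestingFactor f else 1) -
          (if η / 2 + ((j : ℝ) + 1) * η / (2 * m) ≤ diam y.range then y.nestingFactor f else 1)| ≤
        2 * C * τ + if mixed j then 4 * π * C * η ^ 2 else 0 := by
    intro j hj
    have hTj : η / 2 + ((j : ℝ) + 1) * η / (2 * m) ≤ η := cc_threshold_le hη hj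
    have hCτ : 0 ≤ 2 * C * τ := by positivity
    have hD : 0 ≤ 4 * π * C * η ^ 2 := by positivity
    by_cases hx : η / 2 + ((j : ℝ) + 1) * η / (2 * m) ≤ diam x.range <;>
      by_cases hy : η / 2 + ((j : ℝ) + 1) * η / (2 * m) ≤ diam y.range
    · -- both big
      have hnm : ¬ mixed j := by
        rintro (⟨-, h⟩ | ⟨h, -⟩)
        · exact h hy
        · exact h hx
      rw [if_pos hx, if_pos hy, if_neg hnm, add_zero]
      exact hfac
    · -- `x` big, `y` small
      have hmx : mixed j := Or.inl ⟨hx, hy⟩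
      rw [if_pos hx, if_neg hy, if_pos hmx]
      have hdx' : diam x.range ≤ 5 * η / 4 := by
        push Not at hy
        linarith
      linarith [cc_abs_nestingFactor_sub_one_le_of_diam_le (f := f) hC hR hdx']
    · -- `x` small, `y` big
      have hmx : mixed j := Or.inr ⟨hx, hy⟩
      rw [if_neg hx, if_pos hy, if_pos hmx, abs_sub_comm]
      have hdy' : diam y.range ≤ 5 * η / 4 := by
        push Not at hx
        linarith
      linarith [cc_abs_nestingFactor_sub_one_le_of_diam_le (f := f) hC hR hdy']
    · -- both small
      have hnm : ¬ mixed j := by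
        rintro (⟨h, -⟩ | ⟨-, h⟩)
        · exact hx h
        · exact hy h
      rw [if_neg hx, if_neg hy, if_neg hnm, sub_self, abs_zero, add_zero]
      exact hCτ
  have hcard : ((Finset.range m).filter mixed).card ≤ 1 :=
    Finset.card_le_one.2 fun a ha b hb ↦ by
      rw [Finset.mem_filter] at ha hb
      exact cc_threshold_unique hε hmε hdx hdy ha.1 ha.2 hb.2
  calc ∑ j ∈ Finset.range m,
        |(if η / 2 + ((j : ℝ) + 1) * η / (2 * m) ≤ diam x.range then x.nestingFactor f else 1) -
          (if η / 2 + ((j : ℝ) + 1) * η / (2 * m) ≤ diam y.range then y.nestingFactor f else 1)|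
      ≤ ∑ j ∈ Finset.range m, (2 * C * τ + if mixed j then 4 * π * C * η ^ 2 else 0) :=
        Finset.sum_le_sum hterm
    _ = m * (2 * C * τ) + 4 * π * C * η ^ 2 * ((Finset.range m).filter mixed).card := by
        rw [Finset.sum_add_distrib, Finset.sum_const, Finset.card_range, nsmul_eq_mul,
          ← Finset.sum_filter, Finset.sum_const, nsmul_eq_mul]
        ring
    _ ≤ m * (2 * C * τ) + 4 * π * C * η ^ 2 * 1 := by
        gcongr
        exact_mod_cast hcard
    _ = m * (2 * C * τ) + 4 * π * C * η ^ 2 := by ring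

end Pair

/-! ## §4 Matching: relevance of matched loops, uniqueness of partners, existence of partners -/

/-- A loop `ε`-close (`ε ≤ 1`) in `d` to a loop meeting `B̄(0, R)` meets `B̄(0, R + 1)`. -/
theorem cc_nonempty_of_udist_le {x y : UnbasedLoop ℂ} {ε R : ℝ} (hxy : x.udist y ≤ ε) (hε1 : ε ≤ 1)
    (hx : (x.range ∩ closedBall (0 : ℂ) R).Nonempty) :
    (y.range ∩ closedBall (0 : ℂ) (R + 1)).Nonempty := by
  obtain ⟨p, hp, hpR⟩ := hx
  obtain ⟨q, hq, hpq⟩ := x.exists_mem_range_dist_le y hp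
  refine ⟨q, hq, ?_⟩
  rw [mem_closedBall, dist_zero_right] at hpR ⊢
  have h1 := norm_sub_norm_le q p
  rw [← dist_eq_norm, dist_comm] at h1
  linarith

/-- **Both members of a matched pair are relevant.**  If `x ∈ c.loops`, `y ∈ c'.loops`, `d(x, y) ≤ ε ≤ 1`,
`8ε ≤ η`, and one of the two meets `B̄(0, R)` with diameter `≥ η/2`, then both meet `B̄(0, R + 1)` and have
diameter `≥ η/5` (diameters move by `≤ 2ε`, `UnbasedLoop.diam_range_le_of_udist_le`). -/
theorem cc_pair_rel {c c' : LoopConfig ℂ} {ε η R : ℝ} (hε1 : ε ≤ 1) (hεη : 8 * ε ≤ η) (hη : 0 ≤ η)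
    {x y : UnbasedLoop ℂ} (hx : x ∈ c.loops) (hy : y ∈ c'.loops) (hxy : x.udist y ≤ ε)
    (hrel : (x.range ∩ closedBall (0 : ℂ) R).Nonempty ∧ η / 2 ≤ diam x.range ∨
      (y.range ∩ closedBall (0 : ℂ) R).Nonempty ∧ η / 2 ≤ diam y.range) :
    (x ∈ c.loops ∧ (x.range ∩ closedBall (0 : ℂ) (R + 1)).Nonempty ∧ η / 5 ≤ diam x.range) ∧
      (y ∈ c'.loops ∧ (y.range ∩ closedBall (0 : ℂ) (R + 1)).Nonempty ∧ η / 5 ≤ diam y.range) := by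
  have hyx : y.udist x ≤ ε := by rwa [UnbasedLoop.udist_comm]
  have hdx := UnbasedLoop.diam_range_le_of_udist_le x y hxy
  have hdy := UnbasedLoop.diam_range_le_of_udist_le y x hyx
  have mono : ∀ {u : UnbasedLoop ℂ}, (u.range ∩ closedBall (0 : ℂ) R).Nonempty →
      (u.range ∩ closedBall (0 : ℂ) (R + 1)).Nonempty := fun h ↦
    h.mono (inter_subset_inter_right _ (closedBall_subset_closedBall (by linarith)))
  rcases hrel with ⟨hxR, hxd⟩ | ⟨hyR, hyd⟩
  · exact ⟨⟨hx, mono hxR, by linarith⟩, ⟨hy, cc_nonempty_of_udist_le hxy hε1 hxR, by linarith⟩⟩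
  · exact ⟨⟨hx, cc_nonempty_of_udist_le hyx hε1 hyR, by linarith⟩, ⟨hy, mono hyR, by linarith⟩⟩

/-- **Ribbon-freeness makes partners unique**: two relevant loops of a `2ε`-separated configuration that are
both `ε`-close to one loop coincide. -/
theorem cc_eq_of_udist_le {d : LoopConfig ℂ} {ε η R : ℝ}
    (hsep : ∀ u ∈ d.loops, ∀ v ∈ d.loops, (u.range ∩ closedBall (0 : ℂ) (R + 1)).Nonempty →
      (v.range ∩ closedBall (0 : ℂ) (R + 1)).Nonempty → η / 5 ≤ diam u.range →
      η / 5 ≤ diam v.range → u ≠ v → 2 * ε < u.udist v)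
    {x y₁ y₂ : UnbasedLoop ℂ}
    (hy₁ : y₁ ∈ d.loops ∧ (y₁.range ∩ closedBall (0 : ℂ) (R + 1)).Nonempty ∧ η / 5 ≤ diam y₁.range)
    (hy₂ : y₂ ∈ d.loops ∧ (y₂.range ∩ closedBall (0 : ℂ) (R + 1)).Nonempty ∧ η / 5 ≤ diam y₂.range)
    (h₁ : x.udist y₁ ≤ ε) (h₂ : x.udist y₂ ≤ ε) : y₁ = y₂ := by
  by_contra hne
  have hlt := hsep y₁ hy₁.1 y₂ hy₂.1 hy₁.2.1 hy₂.2.1 hy₁.2.2 hy₂.2.2 hne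
  have hle : y₁.udist y₂ ≤ 2 * ε :=
    calc y₁.udist y₂ ≤ y₁.udist x + x.udist y₂ := UnbasedLoop.udist_triangle _ _ _
      _ ≤ ε + ε := add_le_add (by rwa [UnbasedLoop.udist_comm]) h₂
      _ = 2 * ε := by ring
  linarith

/-- **Partners exist** (`d_CN ≤ ε` + window): a loop of `d` meeting `B̄(0, R)` with diameter `≥ η/2` lies in the
window `B(0, 1/ε)`, hence has an `ε`-close loop (of the same type) in `d'`. -/
theorem cc_exists_partner {d d' : LoopConfig ℂ} {ε η R : ℝ} (hclose : LoopConfig.IsClose ε d d')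
    (hwin : ∀ u ∈ d.loops, (u.range ∩ closedBall (0 : ℂ) (R + 1)).Nonempty → η / 5 ≤ diam u.range →
      u.range ⊆ ball (0 : ℂ) (1 / ε))
    (hη : 0 ≤ η) {x : UnbasedLoop ℂ} (hx : x ∈ d.loops) (hxR : (x.range ∩ closedBall (0 : ℂ) R).Nonempty)
    (hxd : η / 2 ≤ diam x.range) : ∃ y ∈ d'.loops, x.udist y ≤ ε := by
  have hxR' : (x.range ∩ closedBall (0 : ℂ) (R + 1)).Nonempty :=
    hxR.mono (inter_subset_inter_right _ (closedBall_subset_closedBall (by linarith)))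
  have hball := hwin x hx hxR' (by linarith)
  rcases hx with hx | hx
  · obtain ⟨y, hy, hd⟩ := (hclose 0).1 x hx hball
    exact ⟨y, d'.subset_loops 0 hy, hd⟩
  · obtain ⟨y, hy, hd⟩ := (hclose 1).1 x hx hball
    exact ⟨y, d'.subset_loops 1 hy, hd⟩

/-! ## §5 The truncated weight as a finite product over the matched pairs -/

/-- **The truncated weight at a threshold `t ≥ s` is a finite product over an injectively labelled family
covering the loops meeting `B̄(0, R)` of diameter `≥ s`**: the other big loops contribute the factor `1`
(`range_inter_closedBall_nonempty_of_nestingFactor_ne_one`), and the labelled loops of diameter `< t` are given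
the factor `1` by hand. -/
theorem cc_truncNestingWeight_eq_prod {ι : Type*} {f : ℂ → ℝ} {R : ℝ} (hR : ∀ z, R < ‖z‖ → f z = 0)
    (h0 : ∫ z, f z = 0) (d : LoopConfig ℂ) (P : Finset ι) (proj : ι → UnbasedLoop ℂ)
    (hinj : Set.InjOn proj ↑P) (hmem : ∀ p ∈ P, proj p ∈ d.loops) {s t : ℝ} (hst : s ≤ t)
    (hcov : ∀ x ∈ d.loops, (x.range ∩ closedBall (0 : ℂ) R).Nonempty → s ≤ diam x.range →
      ∃ p ∈ P, proj p = x) :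
    d.truncNestingWeight f t =
      ∏ p ∈ P, (if t ≤ diam (proj p).range then (proj p).nestingFactor f else 1) := by
  classical
  rw [LoopConfig.truncNestingWeight,
    finprod_mem_eq_prod_of_inter_mulSupport_eq (fun u : UnbasedLoop ℂ ↦ u.nestingFactor f)
      (t := (P.image proj).filter fun u ↦ t ≤ diam u.range) ?_]
  · rw [Finset.prod_filter, Finset.prod_image hinj]
  · ext u
    simp only [mem_inter_iff, Function.mem_mulSupport, Finset.coe_filter, Finset.mem_image, mem_setOf_eq,
      LoopConfig.mem_bigLoops_iff]
    constructor
    · rintro ⟨⟨hu, htu⟩, hne⟩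
      have hR' := range_inter_closedBall_nonempty_of_nestingFactor_ne_one hR h0 hne
      obtain ⟨p, hp, rfl⟩ := hcov u hu hR' (hst.trans htu)
      exact ⟨⟨⟨p, hp, rfl⟩, htu⟩, hne⟩
    · rintro ⟨⟨⟨p, hp, rfl⟩, htu⟩, hne⟩
      exact ⟨⟨hmem p hp, htu⟩, hne⟩

/-! ## §6 Averages of products of bounded factors -/

/-- **Abstract averaging step.**  If `W_j = ∏_{p ∈ P} a_j(p)`, `W'_j = ∏_{p ∈ P} b_j(p)` for `j < m` with
`|a|, |b| ≤ 2`, `#P ≤ N₀`, and `Σ_{j<m} |a_j(p) − b_j(p)| ≤ mK + D` for every `p ∈ P`, then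
`|m⁻¹ Σ_j W_j − m⁻¹ Σ_j W'_j| ≤ 2^{N₀} N₀ (K + D/m)` (`Finset.abs_prod_sub_prod_le`). -/
theorem cc_abs_avg_sub_avg_le {ι : Type*} [DecidableEq ι] (P : Finset ι) {m N₀ : ℕ} (hm : 0 < m)
    (hN : P.card ≤ N₀) (W W' : ℕ → ℝ) (a b : ℕ → ι → ℝ) {K D : ℝ} (hK : 0 ≤ K) (hD : 0 ≤ D)
    (hW : ∀ j ∈ Finset.range m, W j = ∏ p ∈ P, a j p)
    (hW' : ∀ j ∈ Finset.range m, W' j = ∏ p ∈ P, b j p)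
    (ha : ∀ j ∈ Finset.range m, ∀ p ∈ P, |a j p| ≤ 2) (hb : ∀ j ∈ Finset.range m, ∀ p ∈ P, |b j p| ≤ 2)
    (hsum : ∀ p ∈ P, ∑ j ∈ Finset.range m, |a j p - b j p| ≤ m * K + D) :
    |(∑ j ∈ Finset.range m, W j) / m - (∑ j ∈ Finset.range m, W' j) / m| ≤
      2 ^ N₀ * N₀ * (K + D / m) := by
  have hm' : (0 : ℝ) < m := by exact_mod_cast hm
  rw [← sub_div, ← Finset.sum_sub_distrib, abs_div, abs_of_pos hm', div_le_iff₀ hm']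
  have hpow : (2 : ℝ) ^ P.card ≤ 2 ^ N₀ := pow_le_pow_right₀ one_le_two hN
  have hcardR : (P.card : ℝ) ≤ N₀ := by exact_mod_cast hN
  have hKD : 0 ≤ m * K + D := by positivity
  calc |∑ j ∈ Finset.range m, (W j - W' j)|
      ≤ ∑ j ∈ Finset.range m, |W j - W' j| := Finset.abs_sum_le_sum_abs _ _
    _ ≤ ∑ j ∈ Finset.range m, 2 ^ P.card * ∑ p ∈ P, |a j p - b j p| :=
        Finset.sum_le_sum fun j hj ↦ by
          rw [hW j hj, hW' j hj]
          exact Finset.abs_prod_sub_prod_le P one_le_two (ha j hj) (hb j hj)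
    _ = 2 ^ P.card * ∑ p ∈ P, ∑ j ∈ Finset.range m, |a j p - b j p| := by
        rw [← Finset.mul_sum, Finset.sum_comm]
    _ ≤ 2 ^ P.card * ∑ p ∈ P, (m * K + D) := by
        gcongr with p hp
        exact hsum p hp
    _ = 2 ^ P.card * P.card * (m * K + D) := by
        rw [Finset.sum_const, nsmul_eq_mul]
        ring
    _ ≤ 2 ^ N₀ * N₀ * (m * K + D) := by
        apply mul_le_mul_of_nonneg_right _ hKD
        exact mul_le_mul hpow hcardR (Nat.cast_nonneg _) (by positivity)
    _ = 2 ^ N₀ * N₀ * (K + D / m) * m := by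
        field_simp

/-! ## §7 Registered sub-goal -/

/-- **Registered sub-goal `closeComparison_pairSum`** (crux stmt-CriticalPhenomena-4836): the per-pair estimate
`cc_sum_abs_sub_le` in closed form with all binders explicit — for `d(x, y) ≤ ε`, `8mε ≤ η`, `0 < m` and the
`ε`-sausage of `x` of area `≤ τ` in `B̄(0, R)`, `Σ_{j<m} |a_{η_j}(x) − a_{η_j}(y)| ≤ m · 2Cτ + 4πCη²`. -/
theorem closeComparison_pairSum :
    ∀ (f : ℂ → ℝ) (R C : ℝ), Measurable f → (∀ z, |f z| ≤ C) → (∀ z, R < ‖z‖ → f z = 0) →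
    ∀ (x y : UnbasedLoop ℂ) (ε η τ : ℝ) (m : ℕ), 0 < ε → 0 < m → 8 * m * ε ≤ η → x.udist y ≤ ε →
    volume.real ({z : ℂ | Metric.infDist z x.range ≤ ε} ∩ Metric.closedBall (0 : ℂ) R) ≤ τ →
    ∑ j ∈ Finset.range m,
      |(if η / 2 + ((j : ℝ) + 1) * η / (2 * m) ≤ Metric.diam x.range then x.nestingFactor f else 1) -
        (if η / 2 + ((j : ℝ) + 1) * η / (2 * m) ≤ Metric.diam y.range then y.nestingFactor f else 1)| ≤
      m * (2 * C * τ) + 4 * π * C * η ^ 2 :=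
  fun _ _ _ hf hC hR _ _ _ _ _ _ hε hm hmε hxy hV ↦ cc_sum_abs_sub_le hf hC hR hε hm hmε hxy hV

end Summit.CriticalPhenomena.CardyFormulaZ2.Cruxes.MagicFormulaT.LineSketch

end
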